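import Summits.Ventures.HSemireg.FormulaNUniform
import Summits.Ventures.HSemireg.FormulaNSqueeze
import Summits.Ventures.HSemireg.WedgeBoxAll
import Summits.Ventures.HSemireg.WedgeFN4

/-!
# Venture HSemireg — FORMULA-N, the UNIFORM-IN-n STATEMENT (3/3): the class side of (S1) on th-7's wedge model for ALL `n`
# («rank = [t^k]P_n(t)²», «ker = C(4n,k) − R_k(n)», `2n²` in degree 2), the saturation (S2) against the model contraction,
# the factor profile `P_n`, and the `n = 2, 3, 4` instances as kernel theorems

HONEST FRAMING. Part of the Lean index of the computation cell `pub-hsemireg` (seat p10, Sunday typer «UNIFORM-IN-n»).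
Finite-dimensional EXTERIOR ALGEBRA over a field ONLY: no variety, no cohomology theory, no sheaf, no semiregularity map is
constructed here; nothing here says that HC / HC_CM / HC_AV holds; no Literature fact is declared or used.  THEOREMS ONLY (no new
definition): this file WIRES the closed forms of `FormulaNUniform.lean` (1/3) to the tree's kernel theorems of th-7 / th-6 —
`WedgeBox.finrank_range_wedgeMap_fac_mul_all` (THEOREM K∘T for the honest box `f₁ ∧ f₂` on `⋀^k K^{4n}`, all `n ≥ 1`, all
`k ≤ 2n`), `FormulaN.fn4_classLevel` (THEOREM T for the point pair, th-6's `PointPairLawAt`), `FormulaN.Squeeze.theoremS`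
(THEOREM S) — so that the (S1) class-side numbers of STRUCTURE.md v1.0-FINAL `9059cdf4f7e18671` §2 read, uniformly in `n`,
    `rank(θ ↦ θ ∧ (f₁ ∧ f₂) ∣ ⋀^k K^{4n}) = boxRank n k = [t^k] P_n(t)²`,  `dim ker = kerDim n k = C(4n,k) − R_k(n)`,
    degree 2, `n ≥ 3`: `rank + 2n = 6n²`, `dim ker = 2n²`;  factor: `rank(θ ↦ θ ∧ (a·1 + b·pt) ∣ ⋀^k K^{2n}) = r_k(n) = [t^k] P_n(t)`,
and records the `n = 2, 3, 4` INSTANCES the coordinator asked for as kernel theorems: `(rank, ker)` on `⋀²` = `(18, 10)`, `(48, 18)`,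
`(88, 32)`; full box profiles `(1,8,18,8,1)`, `(1,12,48,74,48,12,1)`, `(1,16,88,208,274,208,88,16,1)`; factor profiles `(1,4,1)`,
`(1,6,6,1)`, `(1,8,12,8,1)` — the integers of the signed n-table (STRUCTURE §1.1 C2/C3/C4/C14; FORMULA-N PART A §6, PART B §F;
STEP-0's `18 / 10` at `g = 4`; the `48`-tables at `g = 6`; `88 / 32` at `g = 8`), here DERIVED from the all-`n` theorems, not
fitted.  DICTIONARY (quoted, not asserted; th-7 PART B §A.3 / §N, th-6 PART A §2.1): `K^{4n} = U = H¹(X) ⊕ H¹(X′)`-model of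
`HT•(X × X′)`, `f₁ ∧ f₂` = the class `ch(F₁ ⊠ F₂)` of a box of two point-pair / N-transversal 2-secant factors, `θ ↦ θ ∧ box` =
the contraction `⌟ch` up to the sign-blind dictionary; on the REAL carriers the degree-2 number is `contractionRank_pointPairBox`
(`6n² − 2n`, `n ≥ 3`) / `_two` (`18`).  (S2) here = THEOREM S with the MODEL contraction as the bridge target BY VALUE: for ANY
finite-dimensional `Ext2` and maps `ev : ⋀^k K^{4n} → Ext2`, `σ : Ext2 → ⋀K^{4n}` with `σ ∘ ev = (θ ↦ θ ∧ box)` — the bridge is a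
HYPOTHESIS ([BF08] Thm 6.4.2 on paper) — `R_k(n) ≤ dim Ext2` (`δ_E ≥ 0`), and `dim Ext2 = R_k(n)` forces `ev` onto, `σ` injective,
`dim ker ev = kerDim n k` (typed in every degree `k ≤ 2n`).  Nothing here identifies `Ext2` with an Ext group of a sheaf.
-/

open Module

namespace Summit.Ventures.HSemireg.FormulaN.Uniform

/-! ## The box: (S1) class side, all `n`, all degrees -/

section Box

variable (K : Type*) [Field K] {n k : ℕ}

/-- **(S1) CLASS SIDE, uniform in `n`**: on th-7's wedge model the rank of `θ ↦ θ ∧ (f₁ ∧ f₂)` on `⋀^k K^{4n}` is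
`R_k(n) = boxRank n k` for every `n ≥ 1`, `k ≤ 2n` and all factor coefficients `a, a′` with non-zero entries
(`WedgeBox.finrank_range_wedgeMap_fac_mul_all` + `boxRank_closed`). -/
theorem finrank_range_box_eq_boxRank (hn : 0 < n) (hk : k ≤ n + n) {a a' : Fin 2 → K}
    (ha : ∀ α, a α ≠ 0) (ha' : ∀ β, a' β ≠ 0) :
    finrank K (LinearMap.range (WedgeBox.wedgeMap K n k (WedgeBox.fac1 K n a * WedgeBox.fac2 K n a'))) =
      boxRank n k := by
  have h1 := WedgeBox.finrank_range_wedgeMap_fac_mul_all K hn hk ha ha'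
  have h2 := boxRank_closed n k
  omega

/-- … `= [t^k] P_n(t)²` as a polynomial coefficient (STRUCTURE (S1) «`R₂(n) = [t²](2(1+t)ⁿ − 1 − tⁿ)²`», every degree). -/
theorem finrank_range_box_eq_coeff_P_sq (hn : 0 < n) (hk : k ≤ n + n) {a a' : Fin 2 → K}
    (ha : ∀ α, a α ≠ 0) (ha' : ∀ β, a' β ≠ 0) :
    (finrank K (LinearMap.range (WedgeBox.wedgeMap K n k (WedgeBox.fac1 K n a * WedgeBox.fac2 K n a'))) : ℤ) =
      (P n ^ 2).coeff k := by
  rw [finrank_range_box_eq_boxRank K hn hk ha ha', coeff_P_sq]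

/-- `dim ⋀^k K^{4n} = C(4n, k) = dimHT n k` (C1). -/
theorem finrank_exteriorPower_eq_dimHT (n k : ℕ) : finrank K (⋀[K]^k (WedgeBox.N K n)) = dimHT n k := by
  rw [exteriorPower.finrank_eq, finrank_fintype_fun_eq_card, Fintype.card_fin]
  rfl

/-- **(S1) FOURTH NUMBER, uniform in `n`**: `dim ker(θ ↦ θ ∧ (f₁ ∧ f₂) ∣ ⋀^k K^{4n}) = kerDim n k = C(4n,k) − R_k(n)`. -/
theorem finrank_ker_box_eq_kerDim (hn : 0 < n) (hk : k ≤ n + n) {a a' : Fin 2 → K}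
    (ha : ∀ α, a α ≠ 0) (ha' : ∀ β, a' β ≠ 0) :
    finrank K (LinearMap.ker (WedgeBox.wedgeMap K n k (WedgeBox.fac1 K n a * WedgeBox.fac2 K n a'))) =
      kerDim n k := by
  have h1 := LinearMap.finrank_range_add_finrank_ker
    (WedgeBox.wedgeMap K n k (WedgeBox.fac1 K n a * WedgeBox.fac2 K n a'))
  rw [finrank_range_box_eq_boxRank K hn hk ha ha', finrank_exteriorPower_eq_dimHT] at h1
  have h2 := kerDim_add_boxRank n k
  omega

/-- Degree 2, `n ≥ 3` (STRUCTURE C3/C4; (S1)): `rank + 2n = 6n²` and `dim ker = 2n²` UNIFORMLY. -/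
theorem finrank_box_two (hn : 3 ≤ n) {a a' : Fin 2 → K} (ha : ∀ α, a α ≠ 0) (ha' : ∀ β, a' β ≠ 0) :
    finrank K (LinearMap.range (WedgeBox.wedgeMap K n 2 (WedgeBox.fac1 K n a * WedgeBox.fac2 K n a'))) + 2 * n
        = 6 * n ^ 2 ∧
      finrank K (LinearMap.ker (WedgeBox.wedgeMap K n 2 (WedgeBox.fac1 K n a * WedgeBox.fac2 K n a'))) = 2 * n ^ 2 := by
  rw [finrank_range_box_eq_boxRank K (by omega) (by omega) ha ha',
    finrank_ker_box_eq_kerDim K (by omega) (by omega) ha ha']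
  exact ⟨boxRank_two hn, kerDim_two hn⟩

/-- **THE `n = 2, 3, 4` INSTANCES** (kernel): `(rank, dim ker)` of `θ ↦ θ ∧ (f₁ ∧ f₂)` on `⋀²K^{8}`, `⋀²K^{12}`, `⋀²K^{16}` =
`(18, 10)`, `(48, 18)`, `(88, 32)` — the `g = 4 / 6 / 8` class-side integers of the signed n-table (STEP-0 `18 / 10`; the
`48`-tables; `88 / 32`), DERIVED from the all-`n` theorem. -/
theorem instances_degree_two {a a' : Fin 2 → K} (ha : ∀ α, a α ≠ 0) (ha' : ∀ β, a' β ≠ 0) :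
    (finrank K (LinearMap.range (WedgeBox.wedgeMap K 2 2 (WedgeBox.fac1 K 2 a * WedgeBox.fac2 K 2 a'))) = 18 ∧
      finrank K (LinearMap.ker (WedgeBox.wedgeMap K 2 2 (WedgeBox.fac1 K 2 a * WedgeBox.fac2 K 2 a'))) = 10) ∧
    (finrank K (LinearMap.range (WedgeBox.wedgeMap K 3 2 (WedgeBox.fac1 K 3 a * WedgeBox.fac2 K 3 a'))) = 48 ∧
      finrank K (LinearMap.ker (WedgeBox.wedgeMap K 3 2 (WedgeBox.fac1 K 3 a * WedgeBox.fac2 K 3 a'))) = 18) ∧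
    (finrank K (LinearMap.range (WedgeBox.wedgeMap K 4 2 (WedgeBox.fac1 K 4 a * WedgeBox.fac2 K 4 a'))) = 88 ∧
      finrank K (LinearMap.ker (WedgeBox.wedgeMap K 4 2 (WedgeBox.fac1 K 4 a * WedgeBox.fac2 K 4 a'))) = 32) := by
  refine ⟨⟨?_, ?_⟩, ⟨?_, ?_⟩, ⟨?_, ?_⟩⟩
  · rw [finrank_range_box_eq_boxRank K (by omega) (by omega) ha ha']; decide
  · rw [finrank_ker_box_eq_kerDim K (by omega) (by omega) ha ha']; decide
  · rw [finrank_range_box_eq_boxRank K (by omega) (by omega) ha ha']; decide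
  · rw [finrank_ker_box_eq_kerDim K (by omega) (by omega) ha ha']; decide
  · rw [finrank_range_box_eq_boxRank K (by omega) (by omega) ha ha']; decide
  · rw [finrank_ker_box_eq_kerDim K (by omega) (by omega) ha ha']; decide

/-- The `n = 2, 3, 4` instances in EVERY degree: the rank profiles `k ↦ rank(θ ↦ θ ∧ (f₁ ∧ f₂) ∣ ⋀^k)`, `k = 0..2n`, are
`P_2² = (1,8,18,8,1)`, `P_3² = (1,12,48,74,48,12,1)` (`74` = the degree-`n` purity value `4C(6,3) − 6`), `P_4² =
(1,16,88,208,274,208,88,16,1)` (th-7 Σ2/Σ3; FORMULA-N PART A §6). -/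
theorem instances_profiles {a a' : Fin 2 → K} (ha : ∀ α, a α ≠ 0) (ha' : ∀ β, a' β ≠ 0) :
    (List.range 5).map (fun k => finrank K (LinearMap.range
        (WedgeBox.wedgeMap K 2 k (WedgeBox.fac1 K 2 a * WedgeBox.fac2 K 2 a')))) = [1, 8, 18, 8, 1] ∧
    (List.range 7).map (fun k => finrank K (LinearMap.range
        (WedgeBox.wedgeMap K 3 k (WedgeBox.fac1 K 3 a * WedgeBox.fac2 K 3 a')))) = [1, 12, 48, 74, 48, 12, 1] ∧
    (List.range 9).map (fun k => finrank K (LinearMap.range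
        (WedgeBox.wedgeMap K 4 k (WedgeBox.fac1 K 4 a * WedgeBox.fac2 K 4 a')))) =
      [1, 16, 88, 208, 274, 208, 88, 16, 1] := by
  have e : ∀ (m : ℕ) (L : List ℕ), (∀ k ∈ L, k ≤ m + m) → 0 < m →
      L.map (fun k => finrank K (LinearMap.range
        (WedgeBox.wedgeMap K m k (WedgeBox.fac1 K m a * WedgeBox.fac2 K m a')))) = L.map (boxRank m) := by
    intro m L hL hm
    refine List.map_congr_left fun k hk => ?_
    exact finrank_range_box_eq_boxRank K hm (hL k hk) ha ha'
  rw [e 2 _ (by decide) (by omega), e 3 _ (by decide) (by omega), e 4 _ (by decide) (by omega)]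
  decide

end Box

/-! ## (S2) against the model contraction -/

section ModelSaturation

variable (K : Type*) [Field K] {n k : ℕ}
variable {Ext2 : Type*} [AddCommGroup Ext2] [Module K Ext2] [FiniteDimensional K Ext2]

/-- `δ_E ≥ 0` on the model, any degree `k ≤ 2n`: if `σ ∘ ev = (θ ↦ θ ∧ (f₁ ∧ f₂) ∣ ⋀^k K^{4n})` (the bridge, BY VALUE) then
`R_k(n) ≤ dim Ext2`. -/
theorem boxRank_le_finrank_of_bridge (hn : 0 < n) (hk : k ≤ n + n) {a a' : Fin 2 → K} (ha : ∀ α, a α ≠ 0)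
    (ha' : ∀ β, a' β ≠ 0) (ev : (⋀[K]^k (WedgeBox.N K n)) →ₗ[K] Ext2) (σ : Ext2 →ₗ[K] WedgeBox.HT K n)
    (bridge : σ ∘ₗ ev = WedgeBox.wedgeMap K n k (WedgeBox.fac1 K n a * WedgeBox.fac2 K n a')) :
    boxRank n k ≤ finrank K Ext2 := by
  rw [← finrank_range_box_eq_boxRank K hn hk ha ha', ← bridge]
  exact Squeeze.finrank_range_comp_le_mid ev σ

/-- **(S2) on the model** (THEOREM S with the model contraction as bridge target, «in EVERY degree»): for ANY finite-dimensional
`Ext2` and `ev : ⋀^k K^{4n} → Ext2`, `σ : Ext2 → ⋀K^{4n}` with `σ ∘ ev = (θ ↦ θ ∧ (f₁ ∧ f₂))`, the EXTREMAL count `dim Ext2 = R_k(n)`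
forces `ev` onto, `σ` injective, `rank σ = R_k(n)` and `dim ker ev = kerDim n k` (`k = 2`: `2n²` for `n ≥ 3`, `10` at `n = 2`). -/
theorem model_saturation (hn : 0 < n) (hk : k ≤ n + n) {a a' : Fin 2 → K} (ha : ∀ α, a α ≠ 0) (ha' : ∀ β, a' β ≠ 0)
    (ev : (⋀[K]^k (WedgeBox.N K n)) →ₗ[K] Ext2) (σ : Ext2 →ₗ[K] WedgeBox.HT K n)
    (bridge : σ ∘ₗ ev = WedgeBox.wedgeMap K n k (WedgeBox.fac1 K n a * WedgeBox.fac2 K n a'))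
    (hExt : finrank K Ext2 = boxRank n k) :
    Function.Surjective ev ∧ Function.Injective σ ∧ finrank K (LinearMap.range σ) = boxRank n k ∧
      finrank K (LinearMap.ker ev) = kerDim n k := by
  obtain ⟨hsurj, hinj, -, hker, hσ⟩ := Squeeze.theoremS ev σ _ bridge (boxRank n k)
    (finrank_range_box_eq_boxRank K hn hk ha ha') hExt.le
  refine ⟨hsurj, hinj, hσ, ?_⟩
  rw [hker, finrank_exteriorPower_eq_dimHT]
  have h2 := kerDim_add_boxRank n k
  omega

end ModelSaturation

/-! ## The factor: `P_n` itself (THEOREM T via th-6's `PointPairLawAt`) -/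

section Factor

/-- **Factor side, uniform in `n`**: on th-6's model `FormulaN.HT K n = ⋀(K^{Fin n ⊕ Fin n})` the rank of
`θ ↦ θ ∧ (a·1 + b·E_n)` (the point-pair class `a·1 + b·pt`, e.g. `ch(I_p) = 1 − pt`) on `⋀^k` is `r_k(n) = [t^k] P_n(t)` for every
`n ≥ 1`, `k ≤ n`, `a, b ≠ 0`, every field of characteristic `0` (`FormulaN.fn4_classLevel`, third clause = th-7's THEOREM T). -/
theorem finrank_range_pointPair_eq_coeff_P (K : Type) [Field K] [CharZero K] {n k : ℕ} (hn : 1 ≤ n) (hk : k ≤ n)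
    {a b : K} (ha : a ≠ 0) (hb : b ≠ 0) :
    (finrank K (LinearMap.range (wedgeWith K n k fun m => (if m = 0 then a else 0) + (if m = n then b else 0))) : ℤ)
      = (P n).coeff k := by
  rw [coeff_P]
  exact_mod_cast fn4_classLevel.2.2 K n k a b hk ha hb hn

/-- The `n = 2, 3, 4` factor instances: rank profiles `(1,4,1)`, `(1,6,6,1)`, `(1,8,12,8,1)` = `P_2, P_3, P_4` (STRUCTURE C6:
Markman's window `(1, 2n, n(n−1))` is the head of `P_n`; th-7 Σ1/Σ3). -/
theorem instances_factor (K : Type) [Field K] [CharZero K] {a b : K} (ha : a ≠ 0) (hb : b ≠ 0) :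
    (List.range 3).map (fun k => finrank K (LinearMap.range
        (wedgeWith K 2 k fun m => (if m = 0 then a else 0) + (if m = 2 then b else 0)))) = [1, 4, 1] ∧
    (List.range 4).map (fun k => finrank K (LinearMap.range
        (wedgeWith K 3 k fun m => (if m = 0 then a else 0) + (if m = 3 then b else 0)))) = [1, 6, 6, 1] ∧
    (List.range 5).map (fun k => finrank K (LinearMap.range
        (wedgeWith K 4 k fun m => (if m = 0 then a else 0) + (if m = 4 then b else 0)))) = [1, 8, 12, 8, 1] := by
  have e : ∀ (m : ℕ) (L : List ℕ), (∀ k ∈ L, k ≤ m) → 1 ≤ m →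
      L.map (fun k => finrank K (LinearMap.range
        (wedgeWith K m k fun j => (if j = 0 then a else 0) + (if j = m then b else 0)))) =
        L.map (transversePairRank m) := by
    intro m L hL hm
    refine List.map_congr_left fun k hk => ?_
    exact fn4_classLevel.2.2 K m k a b (hL k hk) ha hb hm
  rw [e 2 _ (by decide) (by omega), e 3 _ (by decide) (by omega), e 4 _ (by decide) (by omega)]
  decide

end Factor

end Summit.Ventures.HSemireg.FormulaN.Uniform
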